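import Summits.MatrixMultiplication.OmegaCensus.CubeLawParityParseval
import HarnessLib

/-!
# Parseval over `𝔽₂³` for the sign characters `(−1)^{w·Ψ}` and the `mod 8` consequence

ω-census `pub-omega`, family (b3), seat pub-omega-group gen 13.  Framing: lottery ticket; floor = certified bounds/negative
ranges.  VALUE: kernel lemmas (the arithmetic of `CubeLawParityModEight.lean`, extracted for reuse); NOT progress on ω.

For `Ψ = (ψ₁, ψ₂, ψ₃) : A → 𝔽₂³` and `X ⊆ A` with fibre counts `n_v = #{x ∈ X : Ψ x = v}`:
* `f2cube_parseval`: `∑_w (∑_{x ∈ X} (−1)^{w·Ψ x})² = 8 ∑_v n_v²`;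
* `card_eq_sum_fibres`: `|X| = ∑_v n_v`;
* `mod_eight_of_sq_add_seven`: `x² + 7 = 8N` with `N + x` even forces `x ≡ ±1 (mod 8)`;
* `even_sum_sq_add_sum`: `∑ n_v² + ∑ n_v` is even.
Used by `DicyclicClassBGeneral.lean` (class B of the dicyclic law for odd-part quotients) exactly as
`cube_part_mod_eight` uses them inline for the cube shapes of the mod-one law.
-/

namespace Summit.MatrixMultiplication.OmegaCensus

open Finset

/-- `x² + 7 = 8N` with `N + x` even forces `x ≡ 1` or `7 (mod 8)`. [folklore] -/
theorem mod_eight_of_sq_add_seven {x N : ℕ} (h : x ^ 2 + 7 = 8 * N) (heven : Even (N + x)) :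
    x % 8 = 1 ∨ x % 8 = 7 := by
  obtain ⟨m, hm⟩ := heven
  set X := x ^ 2 with hX
  have hsq : X % 16 = (x % 16) ^ 2 % 16 := by rw [hX, Nat.pow_mod]
  have hr16 : x % 16 < 16 := Nat.mod_lt _ (by norm_num)
  obtain ⟨r, hr, hxr⟩ : ∃ r, r < 16 ∧ x % 16 = r := ⟨_, hr16, rfl⟩
  rw [hxr] at hsq
  interval_cases r <;> norm_num at hsq <;> omega

/-- `∑ (n_v² + n_v)` is even. [folklore] -/
theorem even_sum_sq_add_sum {ι : Type*} (s : Finset ι) (n : ι → ℕ) :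
    Even (∑ v ∈ s, n v * n v + ∑ v ∈ s, n v) := by
  rw [← sum_add_distrib]
  refine even_sum _ fun v _ => ?_
  rw [← Nat.mul_succ]
  exact Nat.even_mul_succ_self _

section Parseval

variable {A : Type*}

/-- `|X| = ∑_v #{x ∈ X : Ψ x = v}`. [folklore] -/
theorem card_eq_sum_fibres (Ψ : A → ZMod 2 × ZMod 2 × ZMod 2) (X : Finset A) :
    X.card = ∑ v : ZMod 2 × ZMod 2 × ZMod 2, (X.filter fun x => Ψ x = v).card :=
  card_eq_sum_card_fiberwise (f := Ψ) (t := univ) fun _ _ => mem_univ _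

/-- **Parseval over `𝔽₂³`.**  For an additive `Ψ : A → 𝔽₂³` and the sign characters
`s_w(u) = (−1)^{w·u}`: `∑_w (∑_{x∈X} s_w(Ψ x))² = 8 ∑_v n_v²` with `n_v = #{x ∈ X : Ψ x = v}`. [folklore] -/
theorem f2cube_parseval (Ψ : A → ZMod 2 × ZMod 2 × ZMod 2) (X : Finset A) :
    (∑ w : ZMod 2 × ZMod 2 × ZMod 2,
        (∑ x ∈ X, (if w.1 * (Ψ x).1 + w.2.1 * (Ψ x).2.1 + w.2.2 * (Ψ x).2.2 = 0 then (1 : ℤ) else -1)) ^ 2) =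
      8 * ∑ v : ZMod 2 × ZMod 2 × ZMod 2, ((X.filter fun x => Ψ x = v).card : ℤ) * (X.filter fun x => Ψ x = v).card := by
  let s : ZMod 2 × ZMod 2 × ZMod 2 → ZMod 2 × ZMod 2 × ZMod 2 → ℤ :=
    fun w u => if w.1 * u.1 + w.2.1 * u.2.1 + w.2.2 * u.2.2 = 0 then 1 else -1
  show (∑ w : ZMod 2 × ZMod 2 × ZMod 2, (∑ x ∈ X, s w (Ψ x)) ^ 2) = _
  set N := ((X ×ˢ X).filter fun p : A × A => Ψ p.1 + Ψ p.2 = 0).card with hN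
  have hpars : (∑ w : ZMod 2 × ZMod 2 × ZMod 2, (∑ t ∈ X, s w (Ψ t)) ^ 2) = 8 * N := by
    have step : ∀ w : ZMod 2 × ZMod 2 × ZMod 2,
        (∑ t ∈ X, s w (Ψ t)) ^ 2 = ∑ p ∈ X ×ˢ X, s w (Ψ p.1 + Ψ p.2) := by
      intro w
      rw [sq, sum_mul_sum, ← sum_product']
      exact sum_congr rfl fun p _ => f2cube_mul w (Ψ p.1) (Ψ p.2)
    simp_rw [step]
    rw [sum_comm]
    have inner : ∀ p ∈ X ×ˢ X, (∑ w : ZMod 2 × ZMod 2 × ZMod 2, s w (Ψ p.1 + Ψ p.2)) =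
        if Ψ p.1 + Ψ p.2 = 0 then 8 else 0 := fun p _ => f2cube_orthogonality _
    rw [sum_congr rfl inner, ← sum_filter, sum_const, nsmul_eq_mul, mul_comm]
  have hVadd : ∀ a b : ZMod 2 × ZMod 2 × ZMod 2, a + b = 0 ↔ b = a := by decide
  have hNfib : N = ∑ v : ZMod 2 × ZMod 2 × ZMod 2, (X.filter fun t => Ψ t = v).card * (X.filter fun t => Ψ t = v).card := by
    rw [hN, card_eq_sum_card_fiberwise (f := fun p : A × A => Ψ p.1) (t := univ) (fun _ _ => mem_univ _)]
    refine sum_congr rfl fun v _ => ?_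
    rw [← card_product]
    congr 1
    ext p
    simp only [mem_filter, mem_product]
    constructor
    · rintro ⟨⟨⟨h1, h2⟩, h3⟩, h4⟩
      exact ⟨⟨h1, h4⟩, h2, by rw [← h4]; exact (hVadd _ _).1 h3⟩
    · rintro ⟨⟨h1, h4⟩, h2, h5⟩
      exact ⟨⟨⟨h1, h2⟩, (hVadd _ _).2 (by rw [h4, h5])⟩, h4⟩
  rw [hpars, hNfib]
  push_cast
  rfl

end Parseval

end Summit.MatrixMultiplication.OmegaCensus
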